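import Mathlib
import HarnessLib
import Summits.Ventures.LatticeQCDFlow.Exactness.NCMCGeneralSpaceEstimatorBias
import Summits.Ventures.LatticeQCDFlow.Exactness.NCMCGeneralSpaceReweightedCLT
import Summits.Ventures.LatticeQCDFlow.Exactness.NCMCGeneralSpaceBennettOptimal

/-!
# The delta-method step for two-sample (acceptance-ratio) estimators: Bennett's functional is the asymptotic variance

HONEST FRAMING: exact (Metropolis-corrected) sampling algorithms for lattice gauge theory;
figures of merit are autocorrelation/cost numbers at stated couplings and volumes; no
continuum-physics claim.

Venture `LatticeQCDFlow` (cell pub-lqcd), topic `Exactness`; FANOUT row 13 (`eng-snf`, GEN-12).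
NEW WORK of the cell (elementary asymptotic statistics on product laws: Mathlib's CLT, Slutsky's
theorem, the strong law, `indepFun_prod`), not a published result; nothing is cited as a fact
(C. H. Bennett, J. Comput. Phys. 22 (1976) 245 and the "delta method" are named only).
Continuation of `NCMCGeneralSpaceBennettOptimal.lean` (GEN-11), whose docstring reads "NOT
formalised: the delta-method step from the estimator to the functional (the functional is the
object, as in Bennett's paper and in the finite file)".  THIS file is that step, for equal sample
sizes: the variance functional `V(α)` minimised there by the Fermi weight IS the variance of the
limiting Gaussian of `√n (ΔF̂_{α,n} − ΔF)`.

## Setting and content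

A Crooks pair `(κF, κR, s, e, W)` from `ν₀` to `ν₁`, `P_F`, `P_R`, `e^{−ΔF} = Z₁/Z₀`; PAIRED
independent sampling: the i.i.d. run `ω : ℕ → E × E` under `Measure.infinitePi (fun _ => P_F ⊗ P_R)`
(`ω i = (ε_i, ε'_i)`: one forward evolution from prior equilibrium, one reverse evolution from target
equilibrium; equal sample sizes `nf = nr = n`).  For a statistic `α : E → ℝ` the two-sample
estimator is `R_n = Σ_{i<n} α(ε_i) e^{−W(ε_i)} / Σ_{i<n} α(ε'_i)` (consistent for `e^{−ΔF}` by the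
two-sample identity `E_F[α e^{−W}] = e^{−ΔF} E_R[α]`, `CrooksPair.integral_exp_neg_work_mul`) and
`ΔF̂_{α,n} = −log R_n`; `V₁(α) = (E_F[(α e^{−W})²]/E_F[α e^{−W}]² − 1) + (E_R[α²]/E_R[α]² − 1)` is
Bennett's functional of `NCMCGeneralSpaceBennettOptimal.lean` at `nf = nr = 1`.

* **`tendstoInDistribution_sqrt_mul_log_sub`** — THE DELTA METHOD FOR `log` along any measurable
  estimator sequence: `R_n → θ > 0` a.s. and `√n (R_n − θ) →d Y₀` imply
  `√n (log R_n − log θ) →d θ⁻¹ Y₀` (`sub_smul_dslope`, continuity of `dslope log θ` at `θ`, Slutsky).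
* **`variance_fst_sub_mul_snd`** — under `μF ⊗ μR`: `Var[f(x) − θ g(y)] = Var f + θ² Var g`
  (`indepFun_prod`, `IndepFun.variance_fun_add`).
* **`CrooksPair.tendstoInDistribution_twoSample_ratio`** — for a positive measurable `α` with
  `α e^{−W} ∈ L²(P_F)`, `α ∈ L²(P_R)`: `√n (R_n − e^{−ΔF}) →d N(0, e^{−2ΔF} V₁(α))` (the ratio delta
  method of `NCMCGeneralSpaceReweightedCLT.lean` over i.i.d. pairs).
* **`CrooksPair.tendstoInDistribution_twoSample_freeEnergy`** — `√n (ΔF̂_{α,n} − ΔF) →d N(0, V₁(α))`.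
  With `bennett_lower_bound` / `bennett_bound_attained` / `bennett_eq_bound_iff` (GEN-11): among all
  two-sample estimators with a positive square-integrable statistic, Bennett's Fermi weight
  `σ(W − ΔF)` (BAR at `nf = nr`) has the least asymptotic variance, `1/G − 2`, uniquely up to a
  constant factor.  Reading for the engine (`snf.estimators.bar`, `snf.twosided`): for independent
  paired evolutions the honest large-`n` error bar of the two-sided estimate with weight `α` is
  `√(V₁(α)/n)`, and BAR's is the smallest.

Scope / NOT CLAIMED: equal sample sizes and independent pairs only (unequal `nf ≠ nr` needs a
two-index limit; correlated chains need block estimates); the self-consistent BAR iteration (the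
weight uses the unknown `ΔF`) is not analysed — the statement is for a FIXED statistic `α`; no rate,
no finite-`n` coverage, no value for any concrete protocol.
-/

namespace Summit.Ventures.LatticeQCDFlow.Exactness.GeneralNCMC

open MeasureTheory ProbabilityTheory Set Filter Finset
open scoped ENNReal NNReal Topology

variable {E : Type*} [MeasurableSpace E]

/-! ## The delta method for `log` along any estimator sequence -/

section LogDelta

variable {Ω'' : Type*} [MeasurableSpace Ω''] {P : Measure Ω''} [IsProbabilityMeasure P]
variable {Ω' : Type*} [MeasurableSpace Ω'] {P' : Measure Ω'} [IsProbabilityMeasure P']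

/-- **The delta method for `log`.**  If measurable estimators `R_n → θ > 0` almost surely and
`√n (R_n − θ) →d Y₀`, then `√n (log R_n − log θ) →d θ⁻¹ Y₀` (exact identity
`log R − log θ = (R − θ) · dslope log θ R`, continuity of `dslope log θ` at `θ`, Slutsky). -/
theorem tendstoInDistribution_sqrt_mul_log_sub {R : ℕ → Ω'' → ℝ} {θ : ℝ} (hθ : 0 < θ)
    (hRm : ∀ n, Measurable (R n)) (hae : ∀ᵐ ω ∂P, Tendsto (fun n => R n ω) atTop (𝓝 θ))
    {Y₀ : Ω' → ℝ}
    (hclt : TendstoInDistribution (fun (n : ℕ) ω => √(n : ℝ) * (R n ω - θ)) atTop Y₀ (fun _ => P) P') :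
    TendstoInDistribution (fun (n : ℕ) ω => √(n : ℝ) * (Real.log (R n ω) - Real.log θ)) atTop
      (fun ω' => θ⁻¹ * Y₀ ω') (fun _ => P) P' := by
  have hBmeas : ∀ n, AEMeasurable (fun ω => dslope Real.log θ (R n ω)) P :=
    fun n => ((measurable_dslope_log θ).comp (hRm n)).aemeasurable
  have hB : TendstoInMeasure P (fun n ω => dslope Real.log θ (R n ω)) atTop (fun _ => θ⁻¹) := by
    refine tendstoInMeasure_of_tendsto_ae (fun n => (hBmeas n).aestronglyMeasurable) ?_
    filter_upwards [hae] with ω hω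
    have hcont : ContinuousAt (dslope Real.log θ) θ :=
      continuousAt_dslope_same.2 (Real.differentiableAt_log hθ.ne')
    have hval : dslope Real.log θ θ = θ⁻¹ := by rw [dslope_same, Real.deriv_log]
    rw [← hval]
    exact hcont.tendsto.comp hω
  have slutsky := hclt.continuous_comp_prodMk_of_tendstoInMeasure_const
    (g := fun p : ℝ × ℝ => p.2 * p.1) (by fun_prop) hB hBmeas
  simp only at slutsky
  convert slutsky using 3 with n ω
  have key := sub_smul_dslope Real.log θ (R n ω)
  rw [smul_eq_mul] at key
  linear_combination (-√(n : ℝ)) * key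

end LogDelta

/-! ## Variance over independent pairs -/

/-- Under the product of two probability laws, `Var[f(x) − θ g(y)] = Var f + θ² Var g`
(the coordinates are independent, `indepFun_prod`). -/
theorem variance_fst_sub_mul_snd (μF μR : Measure E) [IsProbabilityMeasure μF]
    [IsProbabilityMeasure μR] {f g : E → ℝ} (hf : Measurable f) (hg : Measurable g)
    (hf2 : MemLp f 2 μF) (hg2 : MemLp g 2 μR) (θ : ℝ) :
    Var[fun p : E × E => f p.1 - θ * g p.2; μF.prod μR] = Var[f; μF] + θ ^ 2 * Var[g; μR] := by
  have hind : IndepFun (fun p : E × E => f p.1) (fun p : E × E => -(θ * g p.2)) (μF.prod μR) :=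
    indepFun_prod (μ := μF) (ν := μR) (X := f) (Y := fun y => -(θ * g y)) hf (hg.const_mul θ).neg
  have hf2' : MemLp (fun p : E × E => f p.1) 2 (μF.prod μR) :=
    hf2.comp_measurePreserving (measurePreserving_fst (μ := μF) (ν := μR))
  have hg2' : MemLp (fun p : E × E => g p.2) 2 (μF.prod μR) :=
    hg2.comp_measurePreserving (measurePreserving_snd (μ := μF) (ν := μR))
  have hg2'' : MemLp (fun p : E × E => -(θ * g p.2)) 2 (μF.prod μR) := (hg2'.const_mul θ).neg
  have hsum := hind.variance_fun_add hf2' hg2''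
  have hform : (fun p : E × E => f p.1 - θ * g p.2) = fun p => f p.1 + -(θ * g p.2) := by
    funext p
    ring
  have hidF : IdentDistrib (fun p : E × E => f p.1) f (μF.prod μR) μF :=
    { aemeasurable_fst := (hf.comp measurable_fst).aemeasurable
      aemeasurable_snd := hf.aemeasurable
      map_eq := by
        rw [show (fun p : E × E => f p.1) = f ∘ Prod.fst from rfl,
          ← Measure.map_map hf measurable_fst, (measurePreserving_fst (μ := μF) (ν := μR)).map_eq] }
  have hidR : IdentDistrib (fun p : E × E => g p.2) g (μF.prod μR) μR :=
    { aemeasurable_fst := (hg.comp measurable_snd).aemeasurable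
      aemeasurable_snd := hg.aemeasurable
      map_eq := by
        rw [show (fun p : E × E => g p.2) = g ∘ Prod.snd from rfl,
          ← Measure.map_map hg measurable_snd, (measurePreserving_snd (μ := μF) (ν := μR)).map_eq] }
  rw [hform, hsum, variance_fun_neg, variance_const_mul, hidF.variance_eq, hidR.variance_eq]

/-! ## For a Crooks pair: the two-sample estimator with statistic `α` -/

namespace CrooksPair

variable {Ω : Type*} [MeasurableSpace Ω]
variable {ν₀ ν₁ : Measure Ω} {κF κR : Kernel Ω E} {s e : E → Ω} {W : E → ℝ}
variable {Ω' : Type*} [MeasurableSpace Ω'] {P' : Measure Ω'} [IsProbabilityMeasure P']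

/-- **Asymptotic normality of the two-sample estimator of `e^{−ΔF}` (equal sample sizes).**  For
every Crooks pair with `e^{−ΔF} = Z₁/Z₀`, every positive measurable statistic `α` of the record with
`α e^{−W} ∈ L²(P_F)` and `α ∈ L²(P_R)`, along an infinite run of independent PAIRS (one forward
evolution from prior equilibrium, one reverse evolution from target equilibrium; law
`Measure.infinitePi (fun _ => P_F ⊗ P_R)`), the two-sample estimator
`R_n = Σ_{i<n} α(ε_i) e^{−W(ε_i)} / Σ_{i<n} α(ε'_i)` of `e^{−ΔF}` satisfies
`√n (R_n − e^{−ΔF}) →d N(0, e^{−2ΔF} · V₁(α))`,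
`V₁(α) = (E_F[(α e^{−W})²]/E_F[α e^{−W}]² − 1) + (E_R[α²]/E_R[α]² − 1)` — Bennett's variance
functional of `NCMCGeneralSpaceBennettOptimal.lean` at `nf = nr = 1`. -/
theorem tendstoInDistribution_twoSample_ratio [IsFiniteMeasure ν₀] [IsFiniteMeasure ν₁]
    [IsMarkovKernel κF] [IsMarkovKernel κR] (h0 : ν₀ univ ≠ 0) (h1 : ν₁ univ ≠ 0)
    (h : CrooksPair ν₀ ν₁ κF κR s e W) {α : E → ℝ} (hαm : Measurable α) (hαpos : ∀ ε, 0 < α ε)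
    (hA2 : MemLp (fun ε => α ε * Real.exp (-W ε)) 2 (fwdPathLaw ν₀ κF))
    (hB2 : MemLp α 2 (fwdPathLaw ν₁ κR)) {ΔF : ℝ}
    (hΔF : Real.exp (-ΔF) = ((ν₀ univ)⁻¹ * ν₁ univ).toReal) {Y : Ω' → ℝ}
    (hY : HasLaw Y (gaussianReal 0 (Real.exp (-ΔF) ^ 2 *
      (((∫ ε, (α ε * Real.exp (-W ε)) ^ 2 ∂(fwdPathLaw ν₀ κF)) /
          (∫ ε, α ε * Real.exp (-W ε) ∂(fwdPathLaw ν₀ κF)) ^ 2 - 1) +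
        ((∫ ε, α ε ^ 2 ∂(fwdPathLaw ν₁ κR)) / (∫ ε, α ε ∂(fwdPathLaw ν₁ κR)) ^ 2 - 1))).toNNReal) P') :
    haveI := isProbabilityMeasure_fwdPathLaw ν₀ h0 κF
    haveI := isProbabilityMeasure_fwdPathLaw ν₁ h1 κR
    TendstoInDistribution
      (fun (n : ℕ) (ω : ℕ → E × E) => √(n : ℝ) *
        ((∑ i ∈ range n, α (ω i).1 * Real.exp (-W (ω i).1)) / (∑ i ∈ range n, α (ω i).2) -
          Real.exp (-ΔF)))
      atTop Y (fun _ => Measure.infinitePi fun _ : ℕ => (fwdPathLaw ν₀ κF).prod (fwdPathLaw ν₁ κR))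
      P' := by
  haveI := isProbabilityMeasure_fwdPathLaw ν₀ h0 κF
  haveI := isProbabilityMeasure_fwdPathLaw ν₁ h1 κR
  set μ := (fwdPathLaw ν₀ κF).prod (fwdPathLaw ν₁ κR) with hμ
  -- the two coordinates of a pair, as functions on `E × E`
  have ham : Measurable fun p : E × E => α p.1 * Real.exp (-W p.1) :=
    (hαm.mul (Real.measurable_exp.comp h.measurable_W.neg)).comp measurable_fst
  have hbm : Measurable fun p : E × E => α p.2 := hαm.comp measurable_snd
  have ha2 : MemLp (fun p : E × E => α p.1 * Real.exp (-W p.1)) 2 μ :=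
    hA2.comp_measurePreserving (measurePreserving_fst (μ := fwdPathLaw ν₀ κF) (ν := fwdPathLaw ν₁ κR))
  have hb2 : MemLp (fun p : E × E => α p.2) 2 μ :=
    hB2.comp_measurePreserving (measurePreserving_snd (μ := fwdPathLaw ν₀ κF) (ν := fwdPathLaw ν₁ κR))
  -- the two means and their ratio `e^{−ΔF}`
  have hia : ∫ p, α p.1 * Real.exp (-W p.1) ∂μ = ∫ ε, α ε * Real.exp (-W ε) ∂(fwdPathLaw ν₀ κF) :=
    integral_comp_of_measurePreserving (measurePreserving_fst (μ := fwdPathLaw ν₀ κF)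
      (ν := fwdPathLaw ν₁ κR)) (hA2.integrable one_le_two).aestronglyMeasurable
  have hib : ∫ p, α p.2 ∂μ = ∫ ε, α ε ∂(fwdPathLaw ν₁ κR) :=
    integral_comp_of_measurePreserving (measurePreserving_snd (μ := fwdPathLaw ν₀ κF)
      (ν := fwdPathLaw ν₁ κR)) (hB2.integrable one_le_two).aestronglyMeasurable
  have hB : 0 < ∫ ε, α ε ∂(fwdPathLaw ν₁ κR) := by
    rw [integral_pos_iff_support_of_nonneg (fun ε => (hαpos ε).le) (hB2.integrable one_le_two)]
    have hsupp : Function.support α = univ := by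
      ext ε
      simp only [Function.mem_support, mem_univ, iff_true]
      exact (hαpos ε).ne'
    rw [hsupp, measure_univ]
    exact one_pos
  have htwo : ∫ ε, α ε * Real.exp (-W ε) ∂(fwdPathLaw ν₀ κF) =
      Real.exp (-ΔF) * ∫ ε, α ε ∂(fwdPathLaw ν₁ κR) := by
    have := h.integral_exp_neg_work_mul h0 h1 hΔF α
    rw [← this]
    refine integral_congr_ae (Eventually.of_forall fun ε => ?_)
    simp only
    ring
  have hratio : (∫ p, α p.1 * Real.exp (-W p.1) ∂μ) / (∫ p, α p.2 ∂μ) = Real.exp (-ΔF) := by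
    rw [hia, hib, htwo, mul_div_assoc, div_self hB.ne', mul_one]
  -- the variance of `a − e^{−ΔF} b` over `b̄²`
  have hvar : Var[fun p : E × E => α p.1 * Real.exp (-W p.1) -
      (∫ p, α p.1 * Real.exp (-W p.1) ∂μ) / (∫ p, α p.2 ∂μ) * α p.2; μ] / (∫ p, α p.2 ∂μ) ^ 2 =
      Real.exp (-ΔF) ^ 2 *
        (((∫ ε, (α ε * Real.exp (-W ε)) ^ 2 ∂(fwdPathLaw ν₀ κF)) /
            (∫ ε, α ε * Real.exp (-W ε) ∂(fwdPathLaw ν₀ κF)) ^ 2 - 1) +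
          ((∫ ε, α ε ^ 2 ∂(fwdPathLaw ν₁ κR)) / (∫ ε, α ε ∂(fwdPathLaw ν₁ κR)) ^ 2 - 1)) := by
    rw [hratio, hib, variance_fst_sub_mul_snd (fwdPathLaw ν₀ κF) (fwdPathLaw ν₁ κR)
      (f := fun ε => α ε * Real.exp (-W ε)) (g := α)
      (hαm.mul (Real.measurable_exp.comp h.measurable_W.neg)) hαm hA2 hB2,
      variance_eq_sub hA2, variance_eq_sub hB2, htwo]
    simp only [Pi.pow_apply]
    have hA : Real.exp (-ΔF) * ∫ ε, α ε ∂(fwdPathLaw ν₁ κR) ≠ 0 := mul_ne_zero (Real.exp_pos _).ne' hB.ne'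
    field_simp
  rw [← hvar] at hY
  have main := tendstoInDistribution_sqrt_mul_ratio_sub μ ham hbm (fun p => hαpos p.2) ha2 hb2 hY
  rw [hratio] at main
  exact main

/-- **The delta-method step for the two-sample free-energy estimate**: with `ΔF̂_{α,n} = −log R_n`,
`√n (ΔF̂_{α,n} − ΔF) →d N(0, V₁(α))`, `V₁(α)` Bennett's variance functional at `nf = nr = 1`
(`NCMCGeneralSpaceBennettOptimal.bennett_lower_bound`: `V₁(α) ≥ 1/G − 2` with equality for the Fermi
weight `σ(W − ΔF)`, `bennett_bound_attained`; uniqueness `…BennettOptimalUnique`).  So among all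
two-sample estimators with a positive square-integrable statistic `α`, BAR has the least ASYMPTOTIC
VARIANCE — the sentence the finite and the general-space Bennett files left as "the functional is
the object". -/
theorem tendstoInDistribution_twoSample_freeEnergy [IsFiniteMeasure ν₀] [IsFiniteMeasure ν₁]
    [IsMarkovKernel κF] [IsMarkovKernel κR] (h0 : ν₀ univ ≠ 0) (h1 : ν₁ univ ≠ 0)
    (h : CrooksPair ν₀ ν₁ κF κR s e W) {α : E → ℝ} (hαm : Measurable α) (hαpos : ∀ ε, 0 < α ε)
    (hA2 : MemLp (fun ε => α ε * Real.exp (-W ε)) 2 (fwdPathLaw ν₀ κF))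
    (hB2 : MemLp α 2 (fwdPathLaw ν₁ κR)) {ΔF : ℝ}
    (hΔF : Real.exp (-ΔF) = ((ν₀ univ)⁻¹ * ν₁ univ).toReal) {Y : Ω' → ℝ}
    (hY : HasLaw Y (gaussianReal 0
      ((((∫ ε, (α ε * Real.exp (-W ε)) ^ 2 ∂(fwdPathLaw ν₀ κF)) /
          (∫ ε, α ε * Real.exp (-W ε) ∂(fwdPathLaw ν₀ κF)) ^ 2 - 1) +
        ((∫ ε, α ε ^ 2 ∂(fwdPathLaw ν₁ κR)) / (∫ ε, α ε ∂(fwdPathLaw ν₁ κR)) ^ 2 - 1))).toNNReal) P') :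
    haveI := isProbabilityMeasure_fwdPathLaw ν₀ h0 κF
    haveI := isProbabilityMeasure_fwdPathLaw ν₁ h1 κR
    TendstoInDistribution
      (fun (n : ℕ) (ω : ℕ → E × E) => √(n : ℝ) *
        (-Real.log ((∑ i ∈ range n, α (ω i).1 * Real.exp (-W (ω i).1)) / (∑ i ∈ range n, α (ω i).2))
          - ΔF))
      atTop Y (fun _ => Measure.infinitePi fun _ : ℕ => (fwdPathLaw ν₀ κF).prod (fwdPathLaw ν₁ κR))
      P' := by
  haveI := isProbabilityMeasure_fwdPathLaw ν₀ h0 κF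
  haveI := isProbabilityMeasure_fwdPathLaw ν₁ h1 κR
  set μ := (fwdPathLaw ν₀ κF).prod (fwdPathLaw ν₁ κR) with hμ
  set θ := Real.exp (-ΔF) with hθdef
  have hθ : 0 < θ := Real.exp_pos _
  set V := ((∫ ε, (α ε * Real.exp (-W ε)) ^ 2 ∂(fwdPathLaw ν₀ κF)) /
          (∫ ε, α ε * Real.exp (-W ε) ∂(fwdPathLaw ν₀ κF)) ^ 2 - 1) +
        ((∫ ε, α ε ^ 2 ∂(fwdPathLaw ν₁ κR)) / (∫ ε, α ε ∂(fwdPathLaw ν₁ κR)) ^ 2 - 1) with hV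
  -- `V ≥ 0`: it is a variance over a square
  have ham : Measurable fun p : E × E => α p.1 * Real.exp (-W p.1) :=
    (hαm.mul (Real.measurable_exp.comp h.measurable_W.neg)).comp measurable_fst
  have hbm : Measurable fun p : E × E => α p.2 := hαm.comp measurable_snd
  -- the ratio CLT against `Y₀ = −θ·Y ~ N(0, θ² V)`; `−` because `ΔF̂ − ΔF = −(log R − log θ)`
  have hB : 0 < ∫ ε, α ε ∂(fwdPathLaw ν₁ κR) := by
    rw [integral_pos_iff_support_of_nonneg (fun ε => (hαpos ε).le) (hB2.integrable one_le_two)]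
    have hsupp : Function.support α = univ := by
      ext ε
      simp only [Function.mem_support, mem_univ, iff_true]
      exact (hαpos ε).ne'
    rw [hsupp, measure_univ]
    exact one_pos
  have hV0 : 0 ≤ V := by
    have h1 : 0 ≤ (∫ ε, (α ε * Real.exp (-W ε)) ^ 2 ∂(fwdPathLaw ν₀ κF)) /
        (∫ ε, α ε * Real.exp (-W ε) ∂(fwdPathLaw ν₀ κF)) ^ 2 - 1 := by
      have hv := variance_nonneg (fun ε => α ε * Real.exp (-W ε)) (fwdPathLaw ν₀ κF)
      rw [variance_eq_sub hA2] at hv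
      simp only [Pi.pow_apply] at hv
      have htwo : ∫ ε, α ε * Real.exp (-W ε) ∂(fwdPathLaw ν₀ κF) =
          Real.exp (-ΔF) * ∫ ε, α ε ∂(fwdPathLaw ν₁ κR) := by
        have := h.integral_exp_neg_work_mul h0 h1 hΔF α
        rw [← this]
        refine integral_congr_ae (Eventually.of_forall fun ε => ?_)
        simp only
        ring
      have hpos : 0 < (∫ ε, α ε * Real.exp (-W ε) ∂(fwdPathLaw ν₀ κF)) ^ 2 := by
        rw [htwo]
        positivity
      rw [sub_nonneg, le_div_iff₀ hpos, one_mul]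
      linarith
    have h2 : 0 ≤ (∫ ε, α ε ^ 2 ∂(fwdPathLaw ν₁ κR)) / (∫ ε, α ε ∂(fwdPathLaw ν₁ κR)) ^ 2 - 1 := by
      have hv := variance_nonneg α (fwdPathLaw ν₁ κR)
      rw [variance_eq_sub hB2] at hv
      simp only [Pi.pow_apply] at hv
      have hpos : 0 < (∫ ε, α ε ∂(fwdPathLaw ν₁ κR)) ^ 2 := by positivity
      rw [sub_nonneg, le_div_iff₀ hpos, one_mul]
      linarith
    rw [hV]
    exact add_nonneg h1 h2
  have hY' : HasLaw Y (gaussianReal 0 (θ ^ 2 * V / θ ^ 2).toNNReal) P' := by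
    rwa [mul_div_cancel_left₀ _ (pow_ne_zero 2 hθ.ne')]
  have hY₀ := hasLaw_const_mul_gaussianReal (v := θ ^ 2 * V) (by positivity) hθ.ne' (neg_sq θ) hY'
  have hratioCLT := h.tendstoInDistribution_twoSample_ratio h0 h1 hαm hαpos hA2 hB2 hΔF hY₀
  -- a.s. convergence of `R_n` to `θ` (strong law for both sample means)
  have ha1 : Integrable (fun p : E × E => α p.1 * Real.exp (-W p.1)) μ :=
    (hA2.comp_measurePreserving (measurePreserving_fst (μ := fwdPathLaw ν₀ κF)
      (ν := fwdPathLaw ν₁ κR))).integrable one_le_two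
  have hb1 : Integrable (fun p : E × E => α p.2) μ :=
    (hB2.comp_measurePreserving (measurePreserving_snd (μ := fwdPathLaw ν₀ κF)
      (ν := fwdPathLaw ν₁ κR))).integrable one_le_two
  have hia : ∫ p, α p.1 * Real.exp (-W p.1) ∂μ = θ * ∫ ε, α ε ∂(fwdPathLaw ν₁ κR) := by
    rw [integral_comp_of_measurePreserving (measurePreserving_fst (μ := fwdPathLaw ν₀ κF)
      (ν := fwdPathLaw ν₁ κR)) (hA2.integrable one_le_two).aestronglyMeasurable,
      ← h.integral_exp_neg_work_mul h0 h1 hΔF α]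
    refine integral_congr_ae (Eventually.of_forall fun ε => ?_)
    simp only
    ring
  have hib : ∫ p, α p.2 ∂μ = ∫ ε, α ε ∂(fwdPathLaw ν₁ κR) :=
    integral_comp_of_measurePreserving (measurePreserving_snd (μ := fwdPathLaw ν₀ κF)
      (ν := fwdPathLaw ν₁ κR)) (hB2.integrable one_le_two).aestronglyMeasurable
  have hae : ∀ᵐ ω ∂(Measure.infinitePi fun _ : ℕ => μ), Tendsto (fun n : ℕ =>
      (∑ i ∈ range n, α (ω i).1 * Real.exp (-W (ω i).1)) / (∑ i ∈ range n, α (ω i).2))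
      atTop (𝓝 θ) := by
    filter_upwards [tendsto_sampleMean_ae μ ham ha1, tendsto_sampleMean_ae μ hbm hb1] with ω hωa hωb
    rw [hia] at hωa
    rw [hib] at hωb
    have hlim : Tendsto (fun n : ℕ => sampleMean (fun p : E × E => α p.1 * Real.exp (-W p.1))
        (fun i : Fin n => ω i) / sampleMean (fun p : E × E => α p.2) (fun i : Fin n => ω i)) atTop
        (𝓝 θ) := by
      have := hωa.div hωb hB.ne'
      rwa [mul_div_assoc, div_self hB.ne', mul_one] at this
    refine hlim.congr' ?_
    filter_upwards [eventually_gt_atTop 0] with n hn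
    unfold sampleMean
    rw [Fin.sum_univ_eq_sum_range (fun i => α (ω i).1 * Real.exp (-W (ω i).1)) n,
      Fin.sum_univ_eq_sum_range (fun i => α (ω i).2) n]
    have hn' : (n : ℝ) ≠ 0 := by exact_mod_cast hn.ne'
    have hSb : (∑ i ∈ range n, α (ω i).2) ≠ 0 :=
      (sum_pos (fun i _ => hαpos (ω i).2) (nonempty_range_iff.2 hn.ne')).ne'
    field_simp
  have hRm : ∀ n, Measurable fun ω : ℕ → E × E =>
      (∑ i ∈ range n, α (ω i).1 * Real.exp (-W (ω i).1)) / (∑ i ∈ range n, α (ω i).2) := fun n =>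
    (Finset.measurable_sum _ fun i _ => ham.comp (measurable_pi_apply i)).div
      (Finset.measurable_sum _ fun i _ => hbm.comp (measurable_pi_apply i))
  have hlog := tendstoInDistribution_sqrt_mul_log_sub hθ hRm hae hratioCLT
  have hlim : (fun ω' => θ⁻¹ * (-θ * Y ω')) = fun ω' => -Y ω' := by
    funext ω'
    field_simp
  rw [hlim] at hlog
  -- flip the sign: `ΔF̂ − ΔF = −(log R − log θ)`, and `−(−Y) = Y`
  have hneg := hlog.continuous_comp (g := fun x : ℝ => -x) (by fun_prop)
  simp only [Function.comp_def, neg_neg] at hneg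
  convert hneg using 3 with n ω
  rw [hθdef, Real.log_exp]
  ring

end CrooksPair

end Summit.Ventures.LatticeQCDFlow.Exactness.GeneralNCMC
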